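import Summits.HodgeConjecture.HodgeConjecture.Theorems.F0P3cStCharTSSurjOmega          -- ★ p850185 (LH6-p05 g2): the (SHF′) chain with `Ω` a parameter; brings ★ HTwoOfPsi ∕ HShellGlue ∕ LevelFamily ∕ TorusChartIso ∕ TorusDefs
import Summits.HodgeConjecture.HodgeConjecture.Theorems.F0P3cStCharTSShellOrbitalGValue   -- ★ p850100 (LH2-p03 g3) «PSI-SHELL-VALUE»: `exists_normalizedOrbitalIntegral_indicator_shell_eq_twoCoset`; brings ★ GCan `cmDatumLocalCongr_one_apply`
import Summits.HodgeConjecture.HodgeConjecture.Theorems.F0P3cStCharTSConstants           -- ★ p850178 (F0P2-p06) ⑦ «CONSTANTS»: `kappaG_ne_zero`, `ofReal_measureReal_coe_subgroup_ne_zero`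
import Summits.HodgeConjecture.HodgeConjecture.Theorems.F0P3cStCharTSDomBridge           -- ★ p850163 (LH6-p05 g2) «DOM-BRIDGE»: `valued_torusChartEntries_apply`
import Summits.HodgeConjecture.HodgeConjecture.Theorems.F0P3cStCharTSHyperbolicCore      -- ★ (F0P3a-p05) (H2g): `tsupport_indicator_doubleCoset_torusChart_subset_setOf_one_lt_v_trace`
import Summits.HodgeConjecture.HodgeConjecture.Theorems.F0P3cStCharTSStShellTrace        -- ★ p849965 (LH6-p02 g2): `measureReal_doubleCoset_eq_card_mul`
import Summits.HodgeConjecture.HodgeConjecture.Theorems.F0P3cStCharTSPsmTransport        -- ★ (LH6-p01 g2): `torusChart_reflect` (`ι(ω m) = ⟨w₀ ι(m) w₀⁻¹, _⟩`)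
import HarnessLib

/-!
# F0 · P3c · line LH6 «StCharTS» — «SHELLS-TT★» (part 1 of 2): the per-shell tuple of the Hecke-shell test function `𝟙_{K_n ι(u) K_n}` at a dominant chart point
# (support in the trace-open core `Ω°`, torus transform = two-coset step function with explicit `κ ≠ 0`, mass) [Rogawski1990, §12.7 L. 12.7.1 (proof) p. 191; L. 12.7.2 (proof) pp. 193–194]

Cell `pub/hodgecm-mathlib`, crux H413 = `stmt-HodgeConjecture-24833` (`--supports`, helper lane), route HCCMUnconditional; seat LH6-p05 (g3), answering the (TOR)-road
integrator LH6-p01 (g3)'s 2026-09-02T07:22:31Z ∕ 08:00:58Z asks «SHELLS-TT» to the LH6-p05 lineage (SURJ ∕ Hecke road).  THEOREMS ONLY, sorry-free, ★-only imports, no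
definition ∕ instance ∕ notation ∕ named fact.  Part 2 (`F0P3cStCharTSShellsTTLevels`) instantiates at the T1 levels and closes (SHF′°).

THE MATHEMATICS.  `v` non-split (one place `w`, `c·w = w`), `𝓘` an Iwahori datum of the Borel triple of `U(Φ₃)(L⁺_v)`, `n` a level with `K_n ⊆ K_v` deep at `w`
(`|(k_ij − δ_ij)_w| ≤ r < 1`) and normalised by a long Weyl element `w₀` (matrix `Φ₃`), `u = (α, z) ∈ M = E_vˣ × E¹_v` dominant (`|α_w| < 1`) such that `ι u` dominates `K_n`
(F1-G's `hbN ∕ hbNbar ∕ hbexh`), `R` a left transversal of `K_n ∕ (K_n ∩ ι(u)K_nι(u)⁻¹)`.  Put `φ := 𝟙_{K_n ι(u) K_n}`, `M_n := ι⁻¹(M_T ∩ K_n)`.  Then (`shellsTT_of_datum`):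
* `φ ∈ C_c^∞` and `tsupport φ ⊆ K_n ι(u) K_n ⊆ Ω°_w = {γ | 1 < |tr γ|_w}` (★ (H2g));
* `torusTransform φ = κ·(𝟙_{u M_n} + 𝟙_{u M_n} ∘ ω)`, `κ = (2 μM(M_c))⁻¹ · κ_G ≠ 0`, `κ_G = (ν∘e₁⁻¹)(K_n)·#R·δ_B^{1∕2}(ι u)·μ_T(T ∩ K_v) ∕ μ_T(M_T ∩ K_n)` at `μ_T := ι_* μM`
  (★ PSI-SHELL-VALUE: the producer `Ψ` and its value, `exists_psi_torusChart`; ★ `htwo_of_psi`; ★ `torusTransform_eq_of_twoCoset`; ★ ⑦ `kappaG_ne_zero`);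
* the MASS `∫ φ dν = #R·ν(K_n) = 2κ·μM(u M_n)·δ_B^{1∕2}(ι u)⁻¹` (`integral_indicator_doubleCoset` over ★ `measureReal_doubleCoset_eq_card_mul`; `(ν∘e₁⁻¹)(K_n) = ν(K_n)`
  (`map_symm_frame_real_eq`, ★ `cmDatumLocalCongr_one_apply`); `(ι_*μM)(T ∩ K_v) = μM(M_c)` ★ `map_torusChart_real_level_eq`).
Print: «there exists `f ∈ S` such that `F_f` has support in `η^m𝒪^* ∪ η^{−m}𝒪^*`» [L. 12.7.1 proof p. 191] and the Hecke-shell computation of L. 12.7.2's proof [pp. 193–194].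
TECHNIQUE (carriers): the organ's `Gqs L v` and the matrix carrier `U(Φ₃)(L⁺_v) = ↥(unitaryGroupOfForm …)` are the same type under two spellings; as in ★ GValue ∕ ★ ⑦
CONSTANTS both σ-algebra families are binders, and kit lemmas are applied with `@` where an instance would otherwise be synthesised along another defeq path (★ CuspidalOfXIG).
HONEST LABEL: count-neutral helper; HC_CM is proved only modulo the 7 printed citations (2 remaining: hLiu418 = stmt-HodgeConjecture-24832, h413 = stmt-HodgeConjecture-24833)
until rung 0 closes.

## References
* [Rogawski1990] J. D. Rogawski, *Automorphic Representations of Unitary Groups in Three Variables*, Ann. of Math. Stud. 123 (1990): §12.7 L. 12.7.1 (proof) p. 191,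
  L. 12.7.2 (proof) pp. 193–194; §4.9 (4.9.4) pp. 55–56; §12.2 p. 173.
* [Casselman1995] W. Casselman, *Introduction to the theory of admissible representations of p-adic reductive groups* (1995 notes): Prop. 1.4.4 p. 14, §1.5 Lemma 1.5.1.
-/

set_option autoImplicit false
-- the mandated namespace has the single-problem summit's repeated segment (`HodgeConjecture.HodgeConjecture`)
set_option linter.dupNamespace false

noncomputable section

open NumberField IsDedekindDomain MeasureTheory Measure Topology Filter
open scoped NNReal ENNReal Pointwise MatrixGroups
open ValuativeRel
open Literature.NumberTheory Literature.NumberTheory.Rogawski1990 Literature.NumberTheory.Automorphic Literature.NumberTheory.Automorphic.UnitaryGroup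
open Summit.HodgeConjecture.HodgeConjecture.Cruxes.H413 Summit.HodgeConjecture.HodgeConjecture.Cruxes.H413.F0P3cStCharTSTorusDefs

namespace Summit.HodgeConjecture.HodgeConjecture.Cruxes.H413.F0P3cStCharTSShellsTT

variable (L : Type) [Field L] [NumberField L] [IsCMField L] (v : HeightOneSpectrum (𝓞 ↥(maximalRealSubfield L)))
  (w : PlacesOver L v) (hw : IsCMField.complexConj L • w.1 = w.1)

/-! ## §1 The per-shell tuple at a level `n` of a datum `𝓘` and a dominant chart point `u` (`|u.1_w| < 1`)

Currency (inline, as in ★ `F0P3cStCharTSSurjOmega`): `U := U(Φ₃)(L⁺_v)` (= `Gqs L v`), `M := E_vˣ × E¹_v`, `M_c := 𝒪_vˣ × E¹_v`, `ι := torusChart`, `ω m := ((σ m.1)⁻¹, m.2)`,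
`M_n := ι⁻¹(M_T ∩ K_n) = ((𝓘.K n).subgroupOf M_T).comap torusChartHom`, `Ω°_w := {γ | 1 < |(tr γ)_w|_w}`, `e₁ := cmDatumLocalCongr L v 1 …` (the identity frame). -/

include hw in
set_option maxHeartbeats 4000000 in  -- statement-level cross-spelling `whnf` `Gqs L v` ≡ `↥(unitaryGroupOfForm … (cmLocalForm L 3 v))` (measured class, as ★ GValue ∕ ★ ⑦ CONSTANTS)
set_option synthInstance.maxHeartbeats 400000 in
/-- **THE PRODUCER AT THE CHART POINT `ι u`, IDENTITY FRAME, `μ_T := ι_* μM`** — ★ PSI-SHELL-VALUE `exists_normalizedOrbitalIntegral_indicator_shell_eq_twoCoset` at `b := ι u`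
(`d := torusChartEntries u`, `|d₀|_w = |α_w| < |d₁|_w = 1 < |d₂|_w = |α_w|⁻¹` ★ `valued_torusChartEntries_apply`), classes printed `⟦t⟧` (★ `cmDatumLocalCongr_one_apply`), second
coset at `ι(ω u) = w₀ ι(u) w₀⁻¹` (★ `torusChart_reflect`): the `Ψ κ hΨpt hΨtwo` data of ★ `htwo_of_psi` ∕ ★ `hshell_of_psi_on` for `φ := 𝟙_{K_n ι(u) K_n}`, with
`κ = κ_G := (ν∘e₁⁻¹)(K_n) · #R · δ_B^{1∕2}(ι u) · (ι_*μM)(T ∩ K_v) ∕ (ι_*μM)(M_T ∩ K_n)`. [cite: Rogawski1990, §4.9 (4.9.4) p. 56; §12.7 L. 12.7.2 (proof) pp. 193–194] -/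
theorem exists_psi_torusChart (hns : ∀ w' : PlacesOver L v, IsCMField.complexConj L • w'.1 = w'.1)
    [MeasurableSpace (Gqs L v)] [BorelSpace (Gqs L v)]
    [∀ γ : Gqs L v, MeasurableSpace (Gqs L v ⧸ Subgroup.centralizer ({γ} : Set (Gqs L v)))]
    [∀ γ : Gqs L v, BorelSpace (Gqs L v ⧸ Subgroup.centralizer ({γ} : Set (Gqs L v)))]
    (νQv : Measure (Gqs L v)) [νQv.IsHaarMeasure] [νQv.IsMulRightInvariant]
    {mQv : OrbitalMeasureFamily (Gqs L v)} (hcanQ : mQv.IsCanonical (fun γ => IsRegularElt (γ.val : GL (Fin 3) (UnitaryGroup.LocalRing L v))) νQv)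
    [MeasurableSpace ↥(unitaryGroupOfForm (conjLocal L (IsCMField.complexConj L) v) (cmLocalForm L 3 v))] [BorelSpace ↥(unitaryGroupOfForm (conjLocal L (IsCMField.complexConj L) v) (cmLocalForm L 3 v))]
    [MeasurableSpace ((UnitaryGroup.LocalRing L v)ˣ × ↥(normOneUnits (conjLocal L (IsCMField.complexConj L) v)))] [BorelSpace ((UnitaryGroup.LocalRing L v)ˣ × ↥(normOneUnits (conjLocal L (IsCMField.complexConj L) v)))]
    (μM : Measure ((UnitaryGroup.LocalRing L v)ˣ × ↥(normOneUnits (conjLocal L (IsCMField.complexConj L) v)))) [μM.IsHaarMeasure]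
    (𝓘 : (cmBorelTriple L 3 v).IwahoriDatum) (n : ℕ) {r : WithZero (Multiplicative ℤ)} (hr : r < 1)
    (hKr : ∀ k ∈ 𝓘.K n, ∀ i j : Fin 3, Valued.v ((((k : GL (Fin 3) (LocalRing L v)).val i j - (1 : Matrix (Fin 3) (Fin 3) (LocalRing L v)) i j) : LocalRing L v) w) ≤ r)
    (w₀ : ↥(unitaryGroupOfForm (conjLocal L (IsCMField.complexConj L) v) (cmLocalForm L 3 v))) (hw₀ : Units.val (w₀ : GL (Fin 3) (LocalRing L v)) = cmLocalForm L 3 v)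
    (hKw : ∀ κ ∈ 𝓘.K n, w₀ * κ * w₀⁻¹ ∈ 𝓘.K n)
    (u : ((UnitaryGroup.LocalRing L v)ˣ × ↥(normOneUnits (conjLocal L (IsCMField.complexConj L) v)))) (hu : Valued.v ((u.1 : LocalRing L v) w) < 1)
    (hbN : ∀ x ∈ 𝓘.K n ⊓ (cmBorelTriple L 3 v).N,
        ((F0P3cStCharTSTorusDefs.torusChart L v u : ↥(cmBorelTriple L 3 v).M) : ↥(unitaryGroupOfForm (conjLocal L (IsCMField.complexConj L) v) (cmLocalForm L 3 v))) * x *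
          ((F0P3cStCharTSTorusDefs.torusChart L v u : ↥(cmBorelTriple L 3 v).M) : ↥(unitaryGroupOfForm (conjLocal L (IsCMField.complexConj L) v) (cmLocalForm L 3 v)))⁻¹ ∈ 𝓘.K n)
    (hbNbar : ∀ x ∈ 𝓘.K n ⊓ 𝓘.Nbar,
        ((F0P3cStCharTSTorusDefs.torusChart L v u : ↥(cmBorelTriple L 3 v).M) : ↥(unitaryGroupOfForm (conjLocal L (IsCMField.complexConj L) v) (cmLocalForm L 3 v)))⁻¹ * x *
          ((F0P3cStCharTSTorusDefs.torusChart L v u : ↥(cmBorelTriple L 3 v).M) : ↥(unitaryGroupOfForm (conjLocal L (IsCMField.complexConj L) v) (cmLocalForm L 3 v))) ∈ 𝓘.K n ⊓ 𝓘.Nbar)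
    (hbexh : ∀ x ∈ (cmBorelTriple L 3 v).N, ∃ k : ℕ, ∀ k', k ≤ k' →
        ((F0P3cStCharTSTorusDefs.torusChart L v u : ↥(cmBorelTriple L 3 v).M) : ↥(unitaryGroupOfForm (conjLocal L (IsCMField.complexConj L) v) (cmLocalForm L 3 v))) ^ k' * x *
          (((F0P3cStCharTSTorusDefs.torusChart L v u : ↥(cmBorelTriple L 3 v).M) : ↥(unitaryGroupOfForm (conjLocal L (IsCMField.complexConj L) v) (cmLocalForm L 3 v))) ^ k')⁻¹ ∈ 𝓘.K n)
    {R : Finset ↥(unitaryGroupOfForm (conjLocal L (IsCMField.complexConj L) v) (cmLocalForm L 3 v))}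
    (hR : IsLeftTransversal (𝓘.K n) (𝓘.K n ⊓ ConjAct.toConjAct ((F0P3cStCharTSTorusDefs.torusChart L v u : ↥(cmBorelTriple L 3 v).M) : ↥(unitaryGroupOfForm (conjLocal L (IsCMField.complexConj L) v) (cmLocalForm L 3 v))) • 𝓘.K n) R) :
    haveI := locallyCompactSpace_cmBorelU L 3 v
    ∃ Ψ : ↥(cmBorelTriple L 3 v).M → ℂ,
      (∀ (t : ↥(cmBorelTriple L 3 v).M) (d : Fin 3 → (LocalRing L v)ˣ)
        (hd : glDiagonal 3 (LocalRing L v) d =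
          ((t : ↥(unitaryGroupOfForm (conjLocal L (IsCMField.complexConj L) v) (cmLocalForm L 3 v))) : GL (Fin 3) (LocalRing L v)))
        (ha' : IsUnit ((((d 0)⁻¹ * d 1 : (LocalRing L v)ˣ) : LocalRing L v) - 1))
        (hb' : IsUnit ((((d 0)⁻¹ * d 2 : (LocalRing L v)ˣ) : LocalRing L v) - 1)),
        Ψ t =
            ((rootDeltaChar (cmBorelTriple L 3 v).P
              ⟨(t : ↥(unitaryGroupOfForm (conjLocal L (IsCMField.complexConj L) v) (cmLocalForm L 3 v))), (cmBorelTriple L 3 v).M_le t.2⟩ : ℂˣ) : ℂ) *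
          (((letI : MeasurableSpace (LocalRing L v) := borel _; haveI : BorelSpace (LocalRing L v) := ⟨rfl⟩
            haveI : SecondCountableTopology (LocalRing L v) := secondCountableTopology_localRing (E := L) v
            ((distribHaarChar (LocalRing L v) ha'.unit)⁻¹ *
              (HeisRing.skewModulus (conjLocal L (IsCMField.complexConj L) v) (continuous_conjLocal L (IsCMField.complexConj L) v) hb'.unit
                (HeisRing.map_unit_torusCentralScalar_sub_one (conjLocal L (IsCMField.complexConj L) v) (cmLocalForm_eq_over L 3 v) t hd hb'))⁻¹ :
                  ℝ≥0)) : ℝ) : ℂ)⁻¹ *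
          classOrbitalIntegral mQv ((DoubleCoset.doubleCoset ((F0P3cStCharTSTorusDefs.torusChart L v u : ↥(cmBorelTriple L 3 v).M) : ↥(unitaryGroupOfForm (conjLocal L (IsCMField.complexConj L) v) (cmLocalForm L 3 v))) (𝓘.K n : Set ↥(unitaryGroupOfForm (conjLocal L (IsCMField.complexConj L) v) (cmLocalForm L 3 v))) (𝓘.K n : Set ↥(unitaryGroupOfForm (conjLocal L (IsCMField.complexConj L) v) (cmLocalForm L 3 v)))).indicator fun _ => (1 : ℂ))
            (ConjClasses.mk ((t : ↥(unitaryGroupOfForm (conjLocal L (IsCMField.complexConj L) v) (cmLocalForm L 3 v))) : Gqs L v))) ∧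
      Ψ = fun t => (((((νQv.map (cmDatumLocalCongr L v (1 : GL (Fin 3) (LocalRing L v)) isUnit_one (F0P3cStCharTSDeltaAtLevi.formCongr_one_qsForm L v)).symm : Measure ↥(unitaryGroupOfForm (conjLocal L (IsCMField.complexConj L) v) (cmLocalForm L 3 v)))).real ((𝓘.K n) : Set ↥(unitaryGroupOfForm (conjLocal L (IsCMField.complexConj L) v) (cmLocalForm L 3 v))) : ℂ) * (R.card : ℂ) * ((rootDeltaChar (cmBorelTriple L 3 v).P (Subgroup.inclusion (cmBorelTriple L 3 v).M_le (F0P3cStCharTSTorusDefs.torusChart L v u)) : ℂˣ) : ℂ)) * (((μM.map (F0P3cStCharTSTorusDefs.torusChart L v)).real {t : ↥(cmBorelTriple L 3 v).M | (t : ↥(unitaryGroupOfForm (conjLocal L (IsCMField.complexConj L) v) (cmLocalForm L 3 v))) ∈ cmLocalIntegralLevel L 3 (Matrix.of fun i j : Fin 3 => if i.val + j.val + 1 = 3 then (1 : L) else 0) v} : ℝ) : ℂ)) / (((μM.map (F0P3cStCharTSTorusDefs.torusChart L v)).real (((𝓘.K n).subgroupOf (cmBorelTriple L 3 v).M) : Set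 ↥(cmBorelTriple L 3 v).M) : ℝ) : ℂ) *
        ({t' : ↥(cmBorelTriple L 3 v).M | (F0P3cStCharTSTorusDefs.torusChart L v u)⁻¹ * t' ∈ (((𝓘.K n).subgroupOf (cmBorelTriple L 3 v).M) : Set ↥(cmBorelTriple L 3 v).M)}.indicator (fun _ => (1 : ℂ)) t +
          {t' : ↥(cmBorelTriple L 3 v).M | (F0P3cStCharTSTorusDefs.torusChart L v ((fun p : ((UnitaryGroup.LocalRing L v)ˣ × ↥(normOneUnits (conjLocal L (IsCMField.complexConj L) v))) => ((Units.map ((conjLocal L (IsCMField.complexConj L) v : UnitaryGroup.LocalRing L v →+* UnitaryGroup.LocalRing L v) : UnitaryGroup.LocalRing L v →* UnitaryGroup.LocalRing L v) p.1)⁻¹, p.2)) u))⁻¹ * t' ∈ (((𝓘.K n).subgroupOf (cmBorelTriple L 3 v).M) : Set ↥(cmBorelTriple L 3 v).M)}.indicator (fun _ => (1 : ℂ)) t) := by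
  haveI := locallyCompactSpace_cmBorelU L 3 v
  haveI := F0P3cStCharTSTorusChartIso.isHaarMeasure_map_torusChart L v μM
  -- the diagonal writing of `ι u` and its strictly increasing valuations
  obtain ⟨h0, h1, h2⟩ := F0P3cStCharTSDomBridge.valued_torusChartEntries_apply L v w hw u
  have hα0 : Valued.v ((u.1 : LocalRing L v) w) ≠ 0 := by
    refine (Valuation.ne_zero_iff _).2 fun h => ?_
    have h1' : ((u.1⁻¹ : (LocalRing L v)ˣ) : LocalRing L v) w * (u.1 : LocalRing L v) w = 1 := by rw [← Pi.mul_apply, Units.inv_mul, Pi.one_apply]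
    rw [h, mul_zero] at h1'
    exact zero_ne_one h1'
  have h01 : Valued.v ((((F0P3cStCharTSTorusDefs.torusChartEntries L v u 0 : (LocalRing L v)ˣ) : LocalRing L v) : LocalRing L v) w) <
      Valued.v ((((F0P3cStCharTSTorusDefs.torusChartEntries L v u 1 : (LocalRing L v)ˣ) : LocalRing L v) : LocalRing L v) w) := by
    rw [h0, h1]; exact hu
  have h12 : Valued.v ((((F0P3cStCharTSTorusDefs.torusChartEntries L v u 1 : (LocalRing L v)ˣ) : LocalRing L v) : LocalRing L v) w) <
      Valued.v ((((F0P3cStCharTSTorusDefs.torusChartEntries L v u 2 : (LocalRing L v)ˣ) : LocalRing L v) : LocalRing L v) w) := by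
    rw [h1, h2]; exact (one_lt_inv₀ (zero_lt_iff.2 hα0)).2 hu
  obtain ⟨Ψ, -, -, hpt, htwo⟩ := F0P3cStCharTSShellOrbitalG.exists_normalizedOrbitalIntegral_indicator_shell_eq_twoCoset L hns w hw νQv hcanQ
    (μM.map (F0P3cStCharTSTorusDefs.torusChart L v)) 𝓘 n (𝓘.isOpen_K n) (𝓘.isCompact_K n) hr hKr w₀ hw₀ hKw
    (F0P3cStCharTSTorusDefs.torusChart L v u).2 hbN hbNbar hbexh hR (F0P3cStCharTSTorusDefs.coe_torusChart L v u).symm h01 h12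
  refine ⟨Ψ, fun t d hd ha' hb' => ?_, ?_⟩
  · rw [hpt t d hd ha' hb', F0P3cStCharTSShellOrbitalG.cmDatumLocalCongr_one_apply]
  · rw [htwo]
    funext t
    rw [one_mul, F0P3cStCharTSPsmTransport.torusChart_reflect L v w₀ hw₀ u]
    rfl

/-- `(ν ∘ e₁⁻¹)(S) = ν(S)`: the identity frame `e₁ = cmDatumLocalCongr L v 1 …` is the identity map (★ `cmDatumLocalCongr_one_apply`), so the push-forward of the organ's Haar
measure along `e₁⁻¹` has the same masses (the two σ-algebra spellings are both Borel). [cite: Rogawski1990, §4.9 p. 55] -/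
theorem map_symm_frame_real_eq
    [MeasurableSpace (Gqs L v)] [BorelSpace (Gqs L v)] (νQv : Measure (Gqs L v))
    [MeasurableSpace ↥(unitaryGroupOfForm (conjLocal L (IsCMField.complexConj L) v) (cmLocalForm L 3 v))] [BorelSpace ↥(unitaryGroupOfForm (conjLocal L (IsCMField.complexConj L) v) (cmLocalForm L 3 v))]
    (S : Set ↥(unitaryGroupOfForm (conjLocal L (IsCMField.complexConj L) v) (cmLocalForm L 3 v))) (hS : MeasurableSet S) :
    ((νQv.map (cmDatumLocalCongr L v (1 : GL (Fin 3) (LocalRing L v)) isUnit_one (F0P3cStCharTSDeltaAtLevi.formCongr_one_qsForm L v)).symm :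
        Measure ↥(unitaryGroupOfForm (conjLocal L (IsCMField.complexConj L) v) (cmLocalForm L 3 v)))).real S =
      νQv.real (S : Set (Gqs L v)) := by
  have hcont : @Continuous (Gqs L v) ↥(unitaryGroupOfForm (conjLocal L (IsCMField.complexConj L) v) (cmLocalForm L 3 v)) _ _ (fun x : Gqs L v => (cmDatumLocalCongr L v (1 : GL (Fin 3) (LocalRing L v)) isUnit_one (F0P3cStCharTSDeltaAtLevi.formCongr_one_qsForm L v)).symm x) := (cmDatumLocalCongr L v (1 : GL (Fin 3) (LocalRing L v)) isUnit_one (F0P3cStCharTSDeltaAtLevi.formCongr_one_qsForm L v)).symm.continuous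
  have hmeas : @Measurable (Gqs L v) ↥(unitaryGroupOfForm (conjLocal L (IsCMField.complexConj L) v) (cmLocalForm L 3 v)) _ _ (cmDatumLocalCongr L v (1 : GL (Fin 3) (LocalRing L v)) isUnit_one (F0P3cStCharTSDeltaAtLevi.formCongr_one_qsForm L v)).symm := hcont.measurable
  have hid : ∀ x : Gqs L v, (cmDatumLocalCongr L v (1 : GL (Fin 3) (LocalRing L v)) isUnit_one (F0P3cStCharTSDeltaAtLevi.formCongr_one_qsForm L v)).symm x = x := by
    intro x
    have h := (cmDatumLocalCongr L v (1 : GL (Fin 3) (LocalRing L v)) isUnit_one (F0P3cStCharTSDeltaAtLevi.formCongr_one_qsForm L v)).symm_apply_apply x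
    rwa [F0P3cStCharTSShellOrbitalG.cmDatumLocalCongr_one_apply] at h
  have hpre : @Set.preimage (Gqs L v) ↥(unitaryGroupOfForm (conjLocal L (IsCMField.complexConj L) v) (cmLocalForm L 3 v)) (cmDatumLocalCongr L v (1 : GL (Fin 3) (LocalRing L v)) isUnit_one (F0P3cStCharTSDeltaAtLevi.formCongr_one_qsForm L v)).symm S = (S : Set (Gqs L v)) := by
    ext x
    rw [Set.mem_preimage, hid]
    exact Iff.rfl
  rw [measureReal_def, measureReal_def, Measure.map_apply hmeas hS, hpre]

set_option maxHeartbeats 4000000 in  -- `exact` across the two carrier spellings of the shell indicator (measured class)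
/-- **`∫ 𝟙_{K b K} dν = #R · ν(K)`** for an open level `K`, any `b` and a left transversal `R` of `K ∕ (K ∩ bKb⁻¹)` (★ `measureReal_doubleCoset_eq_card_mul`).
[cite: Casselman1995, §1.5 Lemma 1.5.1] -/
theorem integral_indicator_doubleCoset
    [MeasurableSpace (Gqs L v)] [BorelSpace (Gqs L v)] (νQv : Measure (Gqs L v)) [νQv.IsHaarMeasure]
    (K : Subgroup ↥(unitaryGroupOfForm (conjLocal L (IsCMField.complexConj L) v) (cmLocalForm L 3 v))) (hKo : IsOpen (K : Set ↥(unitaryGroupOfForm (conjLocal L (IsCMField.complexConj L) v) (cmLocalForm L 3 v))))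
    (b : ↥(unitaryGroupOfForm (conjLocal L (IsCMField.complexConj L) v) (cmLocalForm L 3 v)))
    {R : Finset ↥(unitaryGroupOfForm (conjLocal L (IsCMField.complexConj L) v) (cmLocalForm L 3 v))} (hR : IsLeftTransversal K (K ⊓ ConjAct.toConjAct b • K) R) :
    ∫ g, ((DoubleCoset.doubleCoset b (K : Set ↥(unitaryGroupOfForm (conjLocal L (IsCMField.complexConj L) v) (cmLocalForm L 3 v))) (K : Set ↥(unitaryGroupOfForm (conjLocal L (IsCMField.complexConj L) v) (cmLocalForm L 3 v)))).indicator (fun _ => (1 : ℂ)) : Gqs L v → ℂ) g ∂νQv =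
      (R.card : ℂ) * ((νQv.real ((K : Set ↥(unitaryGroupOfForm (conjLocal L (IsCMField.complexConj L) v) (cmLocalForm L 3 v))) : Set (Gqs L v)) : ℝ) : ℂ) := by
  have hDo : @IsOpen (Gqs L v) _ (DoubleCoset.doubleCoset b (K : Set ↥(unitaryGroupOfForm (conjLocal L (IsCMField.complexConj L) v) (cmLocalForm L 3 v))) (K : Set ↥(unitaryGroupOfForm (conjLocal L (IsCMField.complexConj L) v) (cmLocalForm L 3 v)))) := hKo.mul_left
  have hmeas : @MeasurableSet (Gqs L v) _ (DoubleCoset.doubleCoset b (K : Set ↥(unitaryGroupOfForm (conjLocal L (IsCMField.complexConj L) v) (cmLocalForm L 3 v))) (K : Set ↥(unitaryGroupOfForm (conjLocal L (IsCMField.complexConj L) v) (cmLocalForm L 3 v)))) := hDo.measurableSet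
  -- the organ's Haar measure READ ON THE MATRIX CARRIER (same σ-algebra, pinned once) and ★ `measureReal_doubleCoset_eq_card_mul` applied with `@` — every class
  -- argument a TERM, so nothing is synthesised along another defeq path (the recipe of ★ `F0P3cStCharTSCuspidalOfXIG`)
  letI mU : MeasurableSpace ↥(unitaryGroupOfForm (conjLocal L (IsCMField.complexConj L) v) (cmLocalForm L 3 v)) := ‹MeasurableSpace (Gqs L v)›
  haveI bU : BorelSpace ↥(unitaryGroupOfForm (conjLocal L (IsCMField.complexConj L) v) (cmLocalForm L 3 v)) := ‹BorelSpace (Gqs L v)›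
  haveI : (νQv : Measure ↥(unitaryGroupOfForm (conjLocal L (IsCMField.complexConj L) v) (cmLocalForm L 3 v))).IsHaarMeasure := ‹νQv.IsHaarMeasure›
  have iTG : IsTopologicalGroup ↥(unitaryGroupOfForm (conjLocal L (IsCMField.complexConj L) v) (cmLocalForm L 3 v)) := inferInstance
  have iML : (νQv : Measure ↥(unitaryGroupOfForm (conjLocal L (IsCMField.complexConj L) v) (cmLocalForm L 3 v))).IsMulLeftInvariant := inferInstance
  have hmass := @F0P3cStCharTSStShellTrace.measureReal_doubleCoset_eq_card_mul ↥(unitaryGroupOfForm (conjLocal L (IsCMField.complexConj L) v) (cmLocalForm L 3 v)) _ _ iTG mU bU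
    (νQv : Measure ↥(unitaryGroupOfForm (conjLocal L (IsCMField.complexConj L) v) (cmLocalForm L 3 v))) iML K hKo b R hR
  have h := integral_indicator_const (μ := νQv) (1 : ℂ) hmeas
  rw [Complex.real_smul, mul_one] at h
  refine h.trans ?_
  have hmass' : νQv.real (@DoubleCoset.doubleCoset (Gqs L v) _ b (K : Set ↥(unitaryGroupOfForm (conjLocal L (IsCMField.complexConj L) v) (cmLocalForm L 3 v))) (K : Set ↥(unitaryGroupOfForm (conjLocal L (IsCMField.complexConj L) v) (cmLocalForm L 3 v)))) =
      (R.card : ℝ) * νQv.real ((K : Set ↥(unitaryGroupOfForm (conjLocal L (IsCMField.complexConj L) v) (cmLocalForm L 3 v))) : Set (Gqs L v)) := hmass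
  rw [hmass', Complex.ofReal_mul, Complex.ofReal_natCast]

include hw in
set_option maxHeartbeats 4000000 in  -- cross-spelling `whnf` `Gqs L v` ≡ `↥(unitaryGroupOfForm … (cmLocalForm L 3 v))` (measured class, as ★ GValue ∕ ★ ⑦ CONSTANTS)
set_option synthInstance.maxHeartbeats 400000 in
/-- **«SHELLS-TT★» — THE PER-SHELL TUPLE at a level `n` of a datum `𝓘` (levels in `K_v`, deep at `w`, normalised by a long Weyl element `w₀`, dominated by `ι u`) and a
dominant chart point `u`.**  With `φ := 𝟙_{K_n ι(u) K_n}` and `κ := (2 μM(M_c))⁻¹ · κ_G`: `φ ∈ C_c^∞`; `tsupport φ ⊆ Ω°_w`; `κ ≠ 0`; `torusTransform φ = κ·(𝟙_{u M_n} + 𝟙_{u M_n} ∘ ω)`;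
`∫ φ dν = 2κ · μM(u M_n) · δ_B^{1∕2}(ι u)⁻¹` (`= #R · ν(K_n)`).  Print: «there exists `f ∈ S` such that `F_f` has support in `η^m𝒪^* ∪ η^{−m}𝒪^*`» and the Hecke-shell
computation of L. 12.7.2's proof. [cite: Rogawski1990, §12.7 L. 12.7.1 (proof) p. 191; L. 12.7.2 (proof) pp. 193–194] [cite: Casselman1995, §1.5 Lemma 1.5.1] -/
theorem shellsTT_of_datum (hns : ∀ w' : PlacesOver L v, IsCMField.complexConj L • w'.1 = w'.1)
    [MeasurableSpace (Gqs L v)] [BorelSpace (Gqs L v)]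
    [∀ γ : Gqs L v, MeasurableSpace (Gqs L v ⧸ Subgroup.centralizer ({γ} : Set (Gqs L v)))]
    [∀ γ : Gqs L v, BorelSpace (Gqs L v ⧸ Subgroup.centralizer ({γ} : Set (Gqs L v)))]
    (νQv : Measure (Gqs L v)) [νQv.IsHaarMeasure] [νQv.IsMulRightInvariant]
    {mQv : OrbitalMeasureFamily (Gqs L v)} (hcanQ : mQv.IsCanonical (fun γ => IsRegularElt (γ.val : GL (Fin 3) (UnitaryGroup.LocalRing L v))) νQv)
    [MeasurableSpace ↥(unitaryGroupOfForm (conjLocal L (IsCMField.complexConj L) v) (cmLocalForm L 3 v))] [BorelSpace ↥(unitaryGroupOfForm (conjLocal L (IsCMField.complexConj L) v) (cmLocalForm L 3 v))]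
    [MeasurableSpace ((UnitaryGroup.LocalRing L v)ˣ × ↥(normOneUnits (conjLocal L (IsCMField.complexConj L) v)))] [BorelSpace ((UnitaryGroup.LocalRing L v)ˣ × ↥(normOneUnits (conjLocal L (IsCMField.complexConj L) v)))]
    (μM : Measure ((UnitaryGroup.LocalRing L v)ˣ × ↥(normOneUnits (conjLocal L (IsCMField.complexConj L) v)))) [μM.IsHaarMeasure]
    (𝓘 : (cmBorelTriple L 3 v).IwahoriDatum)
    (hKint : ∀ n, ∀ k ∈ 𝓘.K n, k ∈ cmLocalIntegralLevel L 3 (Matrix.of fun i j : Fin 3 => if i.val + j.val + 1 = 3 then (1 : L) else 0) v)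
    (n : ℕ) {r : WithZero (Multiplicative ℤ)} (hr : r < 1)
    (hKr : ∀ k ∈ 𝓘.K n, ∀ i j : Fin 3, Valued.v ((((k : GL (Fin 3) (LocalRing L v)).val i j - (1 : Matrix (Fin 3) (Fin 3) (LocalRing L v)) i j) : LocalRing L v) w) ≤ r)
    (w₀ : ↥(unitaryGroupOfForm (conjLocal L (IsCMField.complexConj L) v) (cmLocalForm L 3 v))) (hw₀ : Units.val (w₀ : GL (Fin 3) (LocalRing L v)) = cmLocalForm L 3 v)
    (hKw : ∀ κ ∈ 𝓘.K n, w₀ * κ * w₀⁻¹ ∈ 𝓘.K n)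
    (u : ((UnitaryGroup.LocalRing L v)ˣ × ↥(normOneUnits (conjLocal L (IsCMField.complexConj L) v)))) (hu : Valued.v ((u.1 : LocalRing L v) w) < 1)
    (hbN : ∀ x ∈ 𝓘.K n ⊓ (cmBorelTriple L 3 v).N,
        ((F0P3cStCharTSTorusDefs.torusChart L v u : ↥(cmBorelTriple L 3 v).M) : ↥(unitaryGroupOfForm (conjLocal L (IsCMField.complexConj L) v) (cmLocalForm L 3 v))) * x *
          ((F0P3cStCharTSTorusDefs.torusChart L v u : ↥(cmBorelTriple L 3 v).M) : ↥(unitaryGroupOfForm (conjLocal L (IsCMField.complexConj L) v) (cmLocalForm L 3 v)))⁻¹ ∈ 𝓘.K n)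
    (hbNbar : ∀ x ∈ 𝓘.K n ⊓ 𝓘.Nbar,
        ((F0P3cStCharTSTorusDefs.torusChart L v u : ↥(cmBorelTriple L 3 v).M) : ↥(unitaryGroupOfForm (conjLocal L (IsCMField.complexConj L) v) (cmLocalForm L 3 v)))⁻¹ * x *
          ((F0P3cStCharTSTorusDefs.torusChart L v u : ↥(cmBorelTriple L 3 v).M) : ↥(unitaryGroupOfForm (conjLocal L (IsCMField.complexConj L) v) (cmLocalForm L 3 v))) ∈ 𝓘.K n ⊓ 𝓘.Nbar)
    (hbexh : ∀ x ∈ (cmBorelTriple L 3 v).N, ∃ k : ℕ, ∀ k', k ≤ k' →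
        ((F0P3cStCharTSTorusDefs.torusChart L v u : ↥(cmBorelTriple L 3 v).M) : ↥(unitaryGroupOfForm (conjLocal L (IsCMField.complexConj L) v) (cmLocalForm L 3 v))) ^ k' * x *
          (((F0P3cStCharTSTorusDefs.torusChart L v u : ↥(cmBorelTriple L 3 v).M) : ↥(unitaryGroupOfForm (conjLocal L (IsCMField.complexConj L) v) (cmLocalForm L 3 v))) ^ k')⁻¹ ∈ 𝓘.K n)
    {R : Finset ↥(unitaryGroupOfForm (conjLocal L (IsCMField.complexConj L) v) (cmLocalForm L 3 v))}
    (hR : IsLeftTransversal (𝓘.K n) (𝓘.K n ⊓ ConjAct.toConjAct ((F0P3cStCharTSTorusDefs.torusChart L v u : ↥(cmBorelTriple L 3 v).M) : ↥(unitaryGroupOfForm (conjLocal L (IsCMField.complexConj L) v) (cmLocalForm L 3 v))) • 𝓘.K n) R) :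
    haveI := locallyCompactSpace_cmBorelU L 3 v
    IsLocSmooth ((DoubleCoset.doubleCoset ((F0P3cStCharTSTorusDefs.torusChart L v u : ↥(cmBorelTriple L 3 v).M) : ↥(unitaryGroupOfForm (conjLocal L (IsCMField.complexConj L) v) (cmLocalForm L 3 v))) (𝓘.K n : Set ↥(unitaryGroupOfForm (conjLocal L (IsCMField.complexConj L) v) (cmLocalForm L 3 v))) (𝓘.K n : Set ↥(unitaryGroupOfForm (conjLocal L (IsCMField.complexConj L) v) (cmLocalForm L 3 v)))).indicator (fun _ => (1 : ℂ)) : Gqs L v → ℂ) ∧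
    tsupport ((DoubleCoset.doubleCoset ((F0P3cStCharTSTorusDefs.torusChart L v u : ↥(cmBorelTriple L 3 v).M) : ↥(unitaryGroupOfForm (conjLocal L (IsCMField.complexConj L) v) (cmLocalForm L 3 v))) (𝓘.K n : Set ↥(unitaryGroupOfForm (conjLocal L (IsCMField.complexConj L) v) (cmLocalForm L 3 v))) (𝓘.K n : Set ↥(unitaryGroupOfForm (conjLocal L (IsCMField.complexConj L) v) (cmLocalForm L 3 v)))).indicator (fun _ => (1 : ℂ)) : Gqs L v → ℂ) ⊆
      {γ : Gqs L v | 1 < Valued.v ((Pi.evalRingHom (fun w' : PlacesOver L v => w'.1.adicCompletion L) w) ((γ.val : GL (Fin 3) (UnitaryGroup.LocalRing L v)) : Matrix (Fin 3) (Fin 3) (UnitaryGroup.LocalRing L v)).trace)} ∧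
    ((((2 * μM.real ((((Submonoid.pi Set.univ (fun w : PlacesOver L v => (w.1.adicCompletionIntegers L).toSubring.toSubmonoid)).units.prod (⊤ : Subgroup ↥(normOneUnits (conjLocal L (IsCMField.complexConj L) v)))) : Subgroup ((UnitaryGroup.LocalRing L v)ˣ × ↥(normOneUnits (conjLocal L (IsCMField.complexConj L) v)))) : Set ((UnitaryGroup.LocalRing L v)ˣ × ↥(normOneUnits (conjLocal L (IsCMField.complexConj L) v)))))⁻¹ : ℝ) : ℂ) *
        ((((((νQv.map (cmDatumLocalCongr L v (1 : GL (Fin 3) (LocalRing L v)) isUnit_one (F0P3cStCharTSDeltaAtLevi.formCongr_one_qsForm L v)).symm : Measure ↥(unitaryGroupOfForm (conjLocal L (IsCMField.complexConj L) v) (cmLocalForm L 3 v)))).real ((𝓘.K n) : Set ↥(unitaryGroupOfForm (conjLocal L (IsCMField.complexConj L) v) (cmLocalForm L 3 v))) : ℂ) * (R.card : ℂ) * ((rootDeltaChar (cmBorelTriple L 3 v).P (Subgroup.inclusion (cmBorelTriple L 3 v).M_le (F0P3cStCharTSTorusDefs.torusChart L v u)) : ℂˣ) : ℂ)) * (((μM.map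 (F0P3cStCharTSTorusDefs.torusChart L v)).real {t : ↥(cmBorelTriple L 3 v).M | (t : ↥(unitaryGroupOfForm (conjLocal L (IsCMField.complexConj L) v) (cmLocalForm L 3 v))) ∈ cmLocalIntegralLevel L 3 (Matrix.of fun i j : Fin 3 => if i.val + j.val + 1 = 3 then (1 : L) else 0) v} : ℝ) : ℂ)) / (((μM.map (F0P3cStCharTSTorusDefs.torusChart L v)).real (((𝓘.K n).subgroupOf (cmBorelTriple L 3 v).M) : Set ↥(cmBorelTriple L 3 v).M) : ℝ) : ℂ)) ≠ 0) ∧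
    F0P3cStCharTSTorusDefs.torusTransform L v mQv μM ((DoubleCoset.doubleCoset ((F0P3cStCharTSTorusDefs.torusChart L v u : ↥(cmBorelTriple L 3 v).M) : ↥(unitaryGroupOfForm (conjLocal L (IsCMField.complexConj L) v) (cmLocalForm L 3 v))) (𝓘.K n : Set ↥(unitaryGroupOfForm (conjLocal L (IsCMField.complexConj L) v) (cmLocalForm L 3 v))) (𝓘.K n : Set ↥(unitaryGroupOfForm (conjLocal L (IsCMField.complexConj L) v) (cmLocalForm L 3 v)))).indicator (fun _ => (1 : ℂ)) : Gqs L v → ℂ) =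
      (fun m => ((((2 * μM.real ((((Submonoid.pi Set.univ (fun w : PlacesOver L v => (w.1.adicCompletionIntegers L).toSubring.toSubmonoid)).units.prod (⊤ : Subgroup ↥(normOneUnits (conjLocal L (IsCMField.complexConj L) v)))) : Subgroup ((UnitaryGroup.LocalRing L v)ˣ × ↥(normOneUnits (conjLocal L (IsCMField.complexConj L) v)))) : Set ((UnitaryGroup.LocalRing L v)ˣ × ↥(normOneUnits (conjLocal L (IsCMField.complexConj L) v)))))⁻¹ : ℝ) : ℂ) *
        ((((((νQv.map (cmDatumLocalCongr L v (1 : GL (Fin 3) (LocalRing L v)) isUnit_one (F0P3cStCharTSDeltaAtLevi.formCongr_one_qsForm L v)).symm : Measure ↥(unitaryGroupOfForm (conjLocal L (IsCMField.complexConj L) v) (cmLocalForm L 3 v)))).real ((𝓘.K n) : Set ↥(unitaryGroupOfForm (conjLocal L (IsCMField.complexConj L) v) (cmLocalForm L 3 v))) : ℂ) * (R.card : ℂ) * ((rootDeltaChar (cmBorelTriple L 3 v).P (Subgroup.inclusion (cmBorelTriple L 3 v).M_le (F0P3cStCharTSTorusDefs.torusChart L v u)) : ℂˣ) : ℂ))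 * (((μM.map (F0P3cStCharTSTorusDefs.torusChart L v)).real {t : ↥(cmBorelTriple L 3 v).M | (t : ↥(unitaryGroupOfForm (conjLocal L (IsCMField.complexConj L) v) (cmLocalForm L 3 v))) ∈ cmLocalIntegralLevel L 3 (Matrix.of fun i j : Fin 3 => if i.val + j.val + 1 = 3 then (1 : L) else 0) v} : ℝ) : ℂ)) / (((μM.map (F0P3cStCharTSTorusDefs.torusChart L v)).real (((𝓘.K n).subgroupOf (cmBorelTriple L 3 v).M) : Set ↥(cmBorelTriple L 3 v).M) : ℝ) : ℂ)) *
        ((u • ((((𝓘.K n).subgroupOf (cmBorelTriple L 3 v).M).comap (F0P3cStCharTSTorusDefs.torusChartHom L v) : Subgroup ((UnitaryGroup.LocalRing L v)ˣ × ↥(normOneUnits (conjLocal L (IsCMField.complexConj L) v)))) : Set ((UnitaryGroup.LocalRing L v)ˣ × ↥(normOneUnits (conjLocal L (IsCMField.complexConj L) v))))).indicator (fun _ => (1 : ℂ)) m +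
          (u • ((((𝓘.K n).subgroupOf (cmBorelTriple L 3 v).M).comap (F0P3cStCharTSTorusDefs.torusChartHom L v) : Subgroup ((UnitaryGroup.LocalRing L v)ˣ × ↥(normOneUnits (conjLocal L (IsCMField.complexConj L) v)))) : Set ((UnitaryGroup.LocalRing L v)ˣ × ↥(normOneUnits (conjLocal L (IsCMField.complexConj L) v))))).indicator (fun _ => (1 : ℂ)) ((fun p : ((UnitaryGroup.LocalRing L v)ˣ × ↥(normOneUnits (conjLocal L (IsCMField.complexConj L) v))) => ((Units.map ((conjLocal L (IsCMField.complexConj L) v : UnitaryGroup.LocalRing L v →+* UnitaryGroup.LocalRing L v) : UnitaryGroup.LocalRing L v →* UnitaryGroup.LocalRing L v) p.1)⁻¹, p.2)) m)))) ∧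
    ∫ g, ((DoubleCoset.doubleCoset ((F0P3cStCharTSTorusDefs.torusChart L v u : ↥(cmBorelTriple L 3 v).M) : ↥(unitaryGroupOfForm (conjLocal L (IsCMField.complexConj L) v) (cmLocalForm L 3 v))) (𝓘.K n : Set ↥(unitaryGroupOfForm (conjLocal L (IsCMField.complexConj L) v) (cmLocalForm L 3 v))) (𝓘.K n : Set ↥(unitaryGroupOfForm (conjLocal L (IsCMField.complexConj L) v) (cmLocalForm L 3 v)))).indicator (fun _ => (1 : ℂ)) : Gqs L v → ℂ) g ∂νQv =
      2 * ((((2 * μM.real ((((Submonoid.pi Set.univ (fun w : PlacesOver L v => (w.1.adicCompletionIntegers L).toSubring.toSubmonoid)).units.prod (⊤ : Subgroup ↥(normOneUnits (conjLocal L (IsCMField.complexConj L) v)))) : Subgroup ((UnitaryGroup.LocalRing L v)ˣ × ↥(normOneUnits (conjLocal L (IsCMField.complexConj L) v)))) : Set ((UnitaryGroup.LocalRing L v)ˣ × ↥(normOneUnits (conjLocal L (IsCMField.complexConj L) v)))))⁻¹ : ℝ) : ℂ) *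
        ((((((νQv.map (cmDatumLocalCongr L v (1 : GL (Fin 3) (LocalRing L v)) isUnit_one (F0P3cStCharTSDeltaAtLevi.formCongr_one_qsForm L v)).symm : Measure ↥(unitaryGroupOfForm (conjLocal L (IsCMField.complexConj L) v) (cmLocalForm L 3 v)))).real ((𝓘.K n) : Set ↥(unitaryGroupOfForm (conjLocal L (IsCMField.complexConj L) v) (cmLocalForm L 3 v))) : ℂ) * (R.card : ℂ) * ((rootDeltaChar (cmBorelTriple L 3 v).P (Subgroup.inclusion (cmBorelTriple L 3 v).M_le (F0P3cStCharTSTorusDefs.torusChart L v u)) : ℂˣ) : ℂ)) * (((μM.map (F0P3cStCharTSTorusDefs.torusChart L v)).real {t : ↥(cmBorelTriple L 3 v).M | (t : ↥(unitaryGroupOfForm (conjLocal L (IsCMField.complexConj L) v) (cmLocalForm L 3 v))) ∈ cmLocalIntegralLevel L 3 (Matrix.of fun i j : Fin 3 => if i.val + j.val + 1 = 3 then (1 : L) else 0) v} : ℝ) : ℂ)) / (((μM.map (F0P3cStCharTSTorusDefs.torusChart L v)).real (((𝓘.K n).subgroupOf (cmBorelTriple L 3 v).M) : Set ↥(cmBorelTriple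 L 3 v).M) : ℝ) : ℂ))) *
        ((μM.real (u • ((((𝓘.K n).subgroupOf (cmBorelTriple L 3 v).M).comap (F0P3cStCharTSTorusDefs.torusChartHom L v) : Subgroup ((UnitaryGroup.LocalRing L v)ˣ × ↥(normOneUnits (conjLocal L (IsCMField.complexConj L) v)))) : Set ((UnitaryGroup.LocalRing L v)ˣ × ↥(normOneUnits (conjLocal L (IsCMField.complexConj L) v))))) : ℝ) : ℂ) *
        (((rootDeltaChar (cmBorelTriple L 3 v).P (Subgroup.inclusion (cmBorelTriple L 3 v).M_le (F0P3cStCharTSTorusDefs.torusChart L v u)) : ℂˣ) : ℂ))⁻¹ := by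
  haveI := locallyCompactSpace_cmBorelU L 3 v
  haveI := F0P3cStCharTSTorusChartIso.isHaarMeasure_map_torusChart L v μM
  -- the shell indicator is `C_c^∞` and supported in the core `Ω°_w` (★ (H2g))
  have hDo : IsOpen (DoubleCoset.doubleCoset ((F0P3cStCharTSTorusDefs.torusChart L v u : ↥(cmBorelTriple L 3 v).M) : ↥(unitaryGroupOfForm (conjLocal L (IsCMField.complexConj L) v) (cmLocalForm L 3 v))) (𝓘.K n : Set ↥(unitaryGroupOfForm (conjLocal L (IsCMField.complexConj L) v) (cmLocalForm L 3 v))) (𝓘.K n : Set ↥(unitaryGroupOfForm (conjLocal L (IsCMField.complexConj L) v) (cmLocalForm L 3 v)))) :=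
    (𝓘.isOpen_K n).mul_left
  have hDc : IsCompact (DoubleCoset.doubleCoset ((F0P3cStCharTSTorusDefs.torusChart L v u : ↥(cmBorelTriple L 3 v).M) : ↥(unitaryGroupOfForm (conjLocal L (IsCMField.complexConj L) v) (cmLocalForm L 3 v))) (𝓘.K n : Set ↥(unitaryGroupOfForm (conjLocal L (IsCMField.complexConj L) v) (cmLocalForm L 3 v))) (𝓘.K n : Set ↥(unitaryGroupOfForm (conjLocal L (IsCMField.complexConj L) v) (cmLocalForm L 3 v)))) :=
    ((𝓘.isCompact_K n).mul isCompact_singleton).mul (𝓘.isCompact_K n)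
  have hφ : IsLocSmooth (X := Gqs L v) ((DoubleCoset.doubleCoset ((F0P3cStCharTSTorusDefs.torusChart L v u : ↥(cmBorelTriple L 3 v).M) : ↥(unitaryGroupOfForm (conjLocal L (IsCMField.complexConj L) v) (cmLocalForm L 3 v))) (𝓘.K n : Set ↥(unitaryGroupOfForm (conjLocal L (IsCMField.complexConj L) v) (cmLocalForm L 3 v))) (𝓘.K n : Set ↥(unitaryGroupOfForm (conjLocal L (IsCMField.complexConj L) v) (cmLocalForm L 3 v)))).indicator fun _ => (1 : ℂ)) :=
    isLocSmooth_indicator hDo hDc.isClosed hDc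
  have hsupp := F0P3cStCharTSHyperbolicCore.tsupport_indicator_doubleCoset_torusChart_subset_setOf_one_lt_v_trace L v hns w (𝓘.K n) (𝓘.isCompact_K n) hr
    (fun k hk i j => hKr k hk i j) u (ne_of_lt hu) (fun _ => (1 : ℂ))
  -- the producer, `κ_G ≠ 0`, the two-coset identity on `M_T`, the transform formula on `M`
  obtain ⟨Ψ, hΨpt, hΨtwo⟩ := exists_psi_torusChart L v w hw hns νQv hcanQ μM 𝓘 n hr hKr w₀ hw₀ hKw u hu hbN hbNbar hbexh hR
  have hCo : IsOpen ((((𝓘.K n).subgroupOf (cmBorelTriple L 3 v).M)) : Set ↥(cmBorelTriple L 3 v).M) := (𝓘.isOpen_K n).preimage continuous_subtype_val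
  have hCc : IsCompact ((((𝓘.K n).subgroupOf (cmBorelTriple L 3 v).M)) : Set ↥(cmBorelTriple L 3 v).M) :=
    (isClosed_cmBorelTriple_M L v).isClosedEmbedding_subtypeVal.isCompact_preimage (𝓘.isCompact_K n)
  have hκG := F0P3cStCharTSConstants.kappaG_ne_zero L (Rogawski1990.qsForm L) (1 : GL (Fin 3) (LocalRing L v)) isUnit_one (F0P3cStCharTSDeltaAtLevi.formCongr_one_qsForm L v)
    νQv (μM.map (F0P3cStCharTSTorusDefs.torusChart L v)) 𝓘 n (F0P3cStCharTSTorusDefs.torusChart L v u).2 hR ((𝓘.K n).subgroupOf (cmBorelTriple L 3 v).M) hCo hCc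
  have hκ := mul_ne_zero (F0P3cStCharTSHShellGlue.inv_two_mul_measureReal_torusCompactPart_ne_zero L v hns μM) hκG
  have hu' : u ∉ (((Submonoid.pi Set.univ (fun w : PlacesOver L v => (w.1.adicCompletionIntegers L).toSubring.toSubmonoid)).units.prod (⊤ : Subgroup ↥(normOneUnits (conjLocal L (IsCMField.complexConj L) v)))) : Subgroup ((UnitaryGroup.LocalRing L v)ˣ × ↥(normOneUnits (conjLocal L (IsCMField.complexConj L) v)))) :=
    fun h => (ne_of_lt hu) ((F0P3cStCharTSTorusCompactPart.mem_unitsIntegers_iff L v u.1).1 (Subgroup.mem_prod.1 h).1 w)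
  have hCle := F0P3cStCharTSLevelFamily.levelFamily_le_torusCompactPart L v hns 𝓘 hKint n
  have hCω : ∀ x : ((UnitaryGroup.LocalRing L v)ˣ × ↥(normOneUnits (conjLocal L (IsCMField.complexConj L) v))),
      F0P3cStCharTSTorusDefs.torusChart L v x ∈ (𝓘.K n).subgroupOf (cmBorelTriple L 3 v).M →
        F0P3cStCharTSTorusDefs.torusChart L v ((fun p : ((UnitaryGroup.LocalRing L v)ˣ × ↥(normOneUnits (conjLocal L (IsCMField.complexConj L) v))) => ((Units.map ((conjLocal L (IsCMField.complexConj L) v : UnitaryGroup.LocalRing L v →+* UnitaryGroup.LocalRing L v) : UnitaryGroup.LocalRing L v →* UnitaryGroup.LocalRing L v) p.1)⁻¹, p.2)) x) ∈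
          (𝓘.K n).subgroupOf (cmBorelTriple L 3 v).M := by
    intro x hx
    rw [Subgroup.mem_subgroupOf] at hx ⊢
    rw [F0P3cStCharTSPsmTransport.torusChart_reflect L v w₀ hw₀ x]
    exact hKw _ hx
  have htwo := F0P3cStCharTSHTwoOfPsi.htwo_of_psi L v hns mQv ((𝓘.K n).subgroupOf (cmBorelTriple L 3 v).M) hCle u hu' _ Ψ _ hΨpt hΨtwo
  have hT := F0P3cStCharTSHShellGlue.torusTransform_eq_of_twoCoset L v mQv μM ((𝓘.K n).subgroupOf (cmBorelTriple L 3 v).M) hCω u _ _ htwo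
  refine ⟨hφ, hsupp, hκ, hT, ?_⟩
  -- the mass: `#R · ν(K_n)` against the closed form of `κ`
  rw [integral_indicator_doubleCoset L v νQv (𝓘.K n) (𝓘.isOpen_K n) _ hR,
    map_symm_frame_real_eq L v νQv _ (𝓘.isOpen_K n).measurableSet,
    F0P3cStCharTSTorusChartIso.map_torusChart_real_level_eq L v hns μM]
  have hlev : (μM.map (F0P3cStCharTSTorusDefs.torusChart L v)).real (((𝓘.K n).subgroupOf (cmBorelTriple L 3 v).M) : Set ↥(cmBorelTriple L 3 v).M) =
      μM.real ((((𝓘.K n).subgroupOf (cmBorelTriple L 3 v).M).comap (F0P3cStCharTSTorusDefs.torusChartHom L v) : Subgroup ((UnitaryGroup.LocalRing L v)ˣ × ↥(normOneUnits (conjLocal L (IsCMField.complexConj L) v)))) : Set ((UnitaryGroup.LocalRing L v)ˣ × ↥(normOneUnits (conjLocal L (IsCMField.complexConj L) v)))) := by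
    rw [measureReal_def, measureReal_def, Measure.map_apply (F0P3cStCharTSTorusChartIso.continuous_torusChart L v).measurable hCo.measurableSet]
    rfl
  have hsmul : μM.real (u • ((((𝓘.K n).subgroupOf (cmBorelTriple L 3 v).M).comap (F0P3cStCharTSTorusDefs.torusChartHom L v) : Subgroup ((UnitaryGroup.LocalRing L v)ˣ × ↥(normOneUnits (conjLocal L (IsCMField.complexConj L) v)))) : Set ((UnitaryGroup.LocalRing L v)ˣ × ↥(normOneUnits (conjLocal L (IsCMField.complexConj L) v))))) =
      μM.real ((((𝓘.K n).subgroupOf (cmBorelTriple L 3 v).M).comap (F0P3cStCharTSTorusDefs.torusChartHom L v) : Subgroup ((UnitaryGroup.LocalRing L v)ˣ × ↥(normOneUnits (conjLocal L (IsCMField.complexConj L) v)))) : Set ((UnitaryGroup.LocalRing L v)ˣ × ↥(normOneUnits (conjLocal L (IsCMField.complexConj L) v)))) := by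
    rw [measureReal_def, measureReal_def, measure_smul]
  rw [hlev, hsmul]
  have hc : (μM.real ((((Submonoid.pi Set.univ (fun w : PlacesOver L v => (w.1.adicCompletionIntegers L).toSubring.toSubmonoid)).units.prod (⊤ : Subgroup ↥(normOneUnits (conjLocal L (IsCMField.complexConj L) v)))) : Subgroup ((UnitaryGroup.LocalRing L v)ˣ × ↥(normOneUnits (conjLocal L (IsCMField.complexConj L) v)))) : Set ((UnitaryGroup.LocalRing L v)ˣ × ↥(normOneUnits (conjLocal L (IsCMField.complexConj L) v)))) : ℂ) ≠ 0 :=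
    Complex.ofReal_ne_zero.2 (F0P3cStCharTSTorusCompactPart.measure_real_torusCompactPart_pos L v μM (F0P3cStCharTSTorusCompactPart.measure_torusCompactPart_lt_top L v hns μM)).ne'
  have hd : (μM.real ((((𝓘.K n).subgroupOf (cmBorelTriple L 3 v).M).comap (F0P3cStCharTSTorusDefs.torusChartHom L v) : Subgroup ((UnitaryGroup.LocalRing L v)ˣ × ↥(normOneUnits (conjLocal L (IsCMField.complexConj L) v)))) : Set ((UnitaryGroup.LocalRing L v)ˣ × ↥(normOneUnits (conjLocal L (IsCMField.complexConj L) v)))) : ℂ) ≠ 0 :=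
    F0P3cStCharTSConstants.ofReal_measureReal_coe_subgroup_ne_zero μM _ (F0P3cStCharTSLevelFamily.isOpen_levelFamily L v 𝓘 n)
      ((F0P3cStCharTSTorusCompactPart.isCompact_torusCompactPart L v hns).of_isClosed_subset
        (Subgroup.isClosed_of_isOpen _ (F0P3cStCharTSLevelFamily.isOpen_levelFamily L v 𝓘 n)) hCle)
  have hδ : ((rootDeltaChar (cmBorelTriple L 3 v).P (Subgroup.inclusion (cmBorelTriple L 3 v).M_le (F0P3cStCharTSTorusDefs.torusChart L v u)) : ℂˣ) : ℂ) ≠ 0 := Units.ne_zero _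
  have h2 : ((((2 * μM.real ((((Submonoid.pi Set.univ (fun w : PlacesOver L v => (w.1.adicCompletionIntegers L).toSubring.toSubmonoid)).units.prod (⊤ : Subgroup ↥(normOneUnits (conjLocal L (IsCMField.complexConj L) v)))) : Subgroup ((UnitaryGroup.LocalRing L v)ˣ × ↥(normOneUnits (conjLocal L (IsCMField.complexConj L) v)))) : Set ((UnitaryGroup.LocalRing L v)ˣ × ↥(normOneUnits (conjLocal L (IsCMField.complexConj L) v)))))⁻¹ : ℝ) : ℂ)) = ((2 : ℂ) * (μM.real ((((Submonoid.pi Set.univ (fun w : PlacesOver L v => (w.1.adicCompletionIntegers L).toSubring.toSubmonoid)).units.prod (⊤ : Subgroup ↥(normOneUnits (conjLocal L (IsCMField.complexConj L) v)))) : Subgroup ((UnitaryGroup.LocalRing L v)ˣ × ↥(normOneUnits (conjLocal L (IsCMField.complexConj L) v)))) : Set ((UnitaryGroup.LocalRing L v)ˣ × ↥(normOneUnits (conjLocal L (IsCMField.complexConj L) v)))) : ℂ))⁻¹ := by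
    rw [Complex.ofReal_inv, Complex.ofReal_mul, Complex.ofReal_ofNat]
  rw [h2]
  field_simp

end Summit.HodgeConjecture.HodgeConjecture.Cruxes.H413.F0P3cStCharTSShellsTT

end
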